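import Summits.NavierStokesRegularity.NavierStokesRegularity.Theorems.CorkscrewDynamoCorkscrewProfileRelativeEquilibriumReduction
import Summits.NavierStokesRegularity.NavierStokesRegularity.Theorems.CorkscrewDynamoSphereTangentLiouville
import Literature.Analysis.FluidPDE.PineauVicolRSSHolds

/-!
# Route CorkscrewDynamo · crux `CorkscrewProfile` (stmt-NavierStokesRegularity-11282) — necessary conditions on a relative equilibrium

NEGATIVE-SIDE constraints, all UNCONDITIONAL, on the open stub `stub_relativeEquilibrium` of the line
`birth` (`Cruxes/CorkscrewProfile/Lines/birth.lean`), i.e. on relative equilibria of Leray's backward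
system: smooth divergence-free solutions `(V, Q)` on `ℝ³` of

  `ω (e₃ × V − DV·(e₃ × y)) + ½ V + ½ (y·∇)V + (V·∇)V + ∇Q = ΔV`,  `div V = 0`,        (RE_ω)

in the Type-I envelope `(1 + ‖y‖)‖V y‖ ≤ C` (and `|Q y| ≤ C` where the ancient-mild structure is used).

* **Rotation window** (Pineau–Vicol 2026, Theorem 1.4 — DISCHARGED in the tree as
  `pineauVicol2026_rss_liouville_holds` — transported through the co-rotating frame): for every `C > 0`
  there are `α₁, α₂ > 0` such that every solution of (RE_ω) in the envelope with `|ω| < α₁` or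
  `|ω| > α₂` vanishes (`relativeEquilibrium_eq_zero_of_extreme_rotation`); hence a witness of
  `stub_relativeEquilibrium` has `α₁ ≤ |ω| ≤ α₂` (`relativeEquilibrium_rotation_window`). The physical
  field of the rotating wave IS Pineau–Vicol's ansatz `pvAnsatz ω V` on `[−1,0)` with the Type-I bound
  `C/(‖x‖ + √(−t))` (`rotatingWave_isClassical_typeI_pvAnsatz`).
* **Sphere tangency is forbidden** (the route's landed `SphereTangentLiouville`, stmt-1365 — the
  Bullard–Gellman toroidal theorem for Type-I RDSS ancient solutions): a solution of (RE_ω) in the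
  envelope with `⟪y, V y⟫ = 0` everywhere vanishes (`relativeEquilibrium_eq_zero_of_sphereTangent`): a
  corkscrew relative equilibrium has a radial component somewhere.
* `C ≤ 0` carries no profile (`relativeEquilibrium_eq_zero_of_nonpos`).

So the constructor of a corkscrew relative equilibrium must work at intermediate rotation rates
`|ω| ∈ [α₁(C), α₂(C)]` (the regime left open by Pineau–Vicol, Conjecture 1.1 / Tsai 2018 Conj. 8.9)
with a profile that is neither axisymmetric (the stub's non-invariance clause; KNSS 2009) nor tangent
to the spheres about the origin.
-/

noncomputable section

open Set Function MeasureTheory Literature.Analysis.FluidPDE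
open scoped InnerProductSpace

namespace Summit.NavierStokesRegularity.NavierStokesRegularity.Theorems.CorkscrewProfile.Birth

set_option linter.dupNamespace false

/-- The envelope `(1 + ‖y‖)‖V y‖ ≤ C` in Pineau–Vicol's form `‖V y‖ ≤ C/(‖y‖ + 1)`. -/
theorem profile_bound_of_envelope {C : ℝ} {V : (EuclideanSpace ℝ (Fin 3)) → (EuclideanSpace ℝ (Fin 3))}
    (hVb : ∀ y : (EuclideanSpace ℝ (Fin 3)), (1 + ‖y‖) * ‖V y‖ ≤ C) (y : (EuclideanSpace ℝ (Fin 3))) : ‖V y‖ ≤ C / (‖y‖ + 1) := by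
  have h0 : 0 < ‖y‖ + 1 := by positivity
  rw [le_div_iff₀ h0]
  have := hVb y
  linarith [this, mul_comm (1 + ‖y‖) ‖V y‖]

/-- **The rotating wave of a relative equilibrium is Pineau–Vicol's RSS ansatz, classical on `[−1,0)`,
Type I with the envelope constant.** For the rotation family about `e₃` pinned by coordinates and a
smooth divergence-free solution `(V, Q)` of (RE_ω) with `(1 + ‖y‖)‖V y‖ ≤ C`, the physical field
`u = ofLerayOrbit U` of the rotating wave `U(s,y) = R_{ωs} V(R_{−ωs} y)` (pressure
`ofLerayOrbitPressure P`, `P(s,y) = Q(R_{−ωs} y)`) is a classical Navier–Stokes solution (`ν = 1`,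
`f = 0`) on `[−1, 0)`, obeys `‖u(t,x)‖ ≤ C/(‖x‖ + √(−t))` there, and coincides with
`pvAnsatz ω V`. (No pressure bound needed.) -/
theorem rotatingWave_isClassical_typeI_pvAnsatz
    (Rot : ℝ → ((EuclideanSpace ℝ (Fin 3)) ≃ₗᵢ[ℝ] (EuclideanSpace ℝ (Fin 3)))) (ω : ℝ) (V : (EuclideanSpace ℝ (Fin 3)) → (EuclideanSpace ℝ (Fin 3))) (Q : (EuclideanSpace ℝ (Fin 3)) → ℝ) {C : ℝ}
    (hRot : ∀ (φ : ℝ) (x : (EuclideanSpace ℝ (Fin 3))), Rot φ x 0 = Real.cos φ * x 0 - Real.sin φ * x 1 ∧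
        Rot φ x 1 = Real.sin φ * x 0 + Real.cos φ * x 1 ∧ Rot φ x 2 = x 2)
    (hV : ContDiff ℝ (⊤ : ℕ∞) V) (hQ : ContDiff ℝ (⊤ : ℕ∞) Q)
    (hdiv : VectorCalculus.IsDivFree V)
    (hEq : ∀ y : (EuclideanSpace ℝ (Fin 3)),
        ω • (cross (EuclideanSpace.single (2 : Fin 3) (1 : ℝ)) (V y)
              - fderiv ℝ V y (cross (EuclideanSpace.single (2 : Fin 3) (1 : ℝ)) y))
          + (1 / 2 : ℝ) • V y + (1 / 2 : ℝ) • fderiv ℝ V y y + convect V V y + gradient Q y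
          = Laplacian.laplacian V y)
    (hVb : ∀ y : (EuclideanSpace ℝ (Fin 3)), (1 + ‖y‖) * ‖V y‖ ≤ C) :
    IsClassicalNSSolutionOn (Ico (-1) 0) 1 0
        (ofLerayOrbit fun s y => Rot (ω * s) (V (Rot (-(ω * s)) y)))
        (ofLerayOrbitPressure fun s y => Q (Rot (-(ω * s)) y)) ∧
      (∀ t ∈ Ico (-1 : ℝ) 0, ∀ x : (EuclideanSpace ℝ (Fin 3)),
        ‖ofLerayOrbit (fun s y => Rot (ω * s) (V (Rot (-(ω * s)) y))) t x‖ ≤ C / (‖x‖ + Real.sqrt (-t))) ∧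
      (∀ t ∈ Ico (-1 : ℝ) 0, ∀ x : (EuclideanSpace ℝ (Fin 3)),
        ofLerayOrbit (fun s y => Rot (ω * s) (V (Rot (-(ω * s)) y))) t x = pvAnsatz ω (fun y _ => V y) t x) := by
  have hBL := stub_corotatingFrame Rot ω V Q hRot hV hQ hdiv hEq
  have hcl := isClassicalNSSolutionOn_Iio_ofLerayOrbit_iff.2 hBL
  have hans : ∀ t ∈ Ico (-1 : ℝ) 0, ∀ x : (EuclideanSpace ℝ (Fin 3)),
      ofLerayOrbit (fun s y => Rot (ω * s) (V (Rot (-(ω * s)) y))) t x = pvAnsatz ω (fun y _ => V y) t x := by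
    intro t _ x
    simp only [ofLerayOrbit_apply, pvAnsatz]
    rw [rot_eq_rotZ Rot hRot, rot_eq_rotZ Rot hRot]
  refine ⟨hcl.mono Ico_subset_Iio_self (uniqueDiffOn_Ico (-1) 0), fun t ht x => ?_, hans⟩
  rw [hans t ht x]
  exact norm_pvAnsatz_le_of_profile (profile_bound_of_envelope hVb) ht.2 x

/-- **Slow and fast rotations carry no relative equilibrium** (Pineau–Vicol 2026, Theorem 1.4, in the
vocabulary of `stub_relativeEquilibrium`). For every envelope constant `C > 0` there are thresholds
`α₁, α₂ > 0` such that any smooth divergence-free solution `(V, Q)` of the rotating steady Leray system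
(RE_ω) with `(1 + ‖y‖)‖V y‖ ≤ C` and `|ω| < α₁` or `|ω| > α₂` is trivial: `V = 0`. (Rotation family
about `e₃` pinned by coordinates; the pressure needs no bound.) -/
theorem relativeEquilibrium_eq_zero_of_extreme_rotation {C : ℝ} (hC : 0 < C) :
    ∃ α₁ α₂ : ℝ, 0 < α₁ ∧ 0 < α₂ ∧
      ∀ (Rot : ℝ → (EuclideanSpace ℝ (Fin 3) ≃ₗᵢ[ℝ] EuclideanSpace ℝ (Fin 3))) (ω : ℝ)
        (V : EuclideanSpace ℝ (Fin 3) → EuclideanSpace ℝ (Fin 3)) (Q : EuclideanSpace ℝ (Fin 3) → ℝ),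
        (∀ (φ : ℝ) (x : EuclideanSpace ℝ (Fin 3)),
            Rot φ x 0 = Real.cos φ * x 0 - Real.sin φ * x 1 ∧
            Rot φ x 1 = Real.sin φ * x 0 + Real.cos φ * x 1 ∧ Rot φ x 2 = x 2) →
        ContDiff ℝ (⊤ : ℕ∞) V → ContDiff ℝ (⊤ : ℕ∞) Q →
        Literature.Analysis.FluidPDE.VectorCalculus.IsDivFree V →
        (∀ y : EuclideanSpace ℝ (Fin 3),
            ω • (Literature.Analysis.FluidPDE.cross (EuclideanSpace.single (2 : Fin 3) (1 : ℝ)) (V y)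
                  - fderiv ℝ V y (Literature.Analysis.FluidPDE.cross (EuclideanSpace.single (2 : Fin 3) (1 : ℝ)) y))
              + (1 / 2 : ℝ) • V y + (1 / 2 : ℝ) • fderiv ℝ V y y
              + Literature.Analysis.FluidPDE.convect V V y + gradient Q y
              = Laplacian.laplacian V y) →
        (∀ y : EuclideanSpace ℝ (Fin 3), (1 + ‖y‖) * ‖V y‖ ≤ C) →
        (|ω| < α₁ ∨ α₂ < |ω|) → V = 0 := by
  obtain ⟨α₁, α₂, hα₁, hα₂, H⟩ := pineauVicol2026_rss_liouville_holds C hC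
  refine ⟨α₁, α₂, hα₁, hα₂, fun Rot ω V Q hRot hV hQ hdiv hEq hVb hω => ?_⟩
  obtain ⟨hcl, hI, hans⟩ := rotatingWave_isClassical_typeI_pvAnsatz Rot ω V Q hRot hV hQ hdiv hEq hVb
  have hV2 : ContDiff ℝ 2 V := hV.of_le (by norm_cast)
  exact H ω _ _ V hcl hI hV2 hans hω

/-- **The rotation window of a corkscrew relative equilibrium.** For every envelope constant `C > 0`
there are `α₁, α₂ > 0` such that every witness of the body of `stub_relativeEquilibrium` with that
constant — a smooth divergence-free solution `(V, Q)` of (RE_ω) in the envelope `(1 + ‖y‖)‖V y‖ ≤ C`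
that is NOT invariant under the rotation `R_{ωL}` — has `α₁ ≤ |ω| ≤ α₂`: the constructor must work
at intermediate rotation rates, the regime left open by Pineau–Vicol 2026 (Conjecture 1.1). -/
theorem relativeEquilibrium_rotation_window {C : ℝ} (hC : 0 < C) :
    ∃ α₁ α₂ : ℝ, 0 < α₁ ∧ 0 < α₂ ∧
      ∀ (Rot : ℝ → (EuclideanSpace ℝ (Fin 3) ≃ₗᵢ[ℝ] EuclideanSpace ℝ (Fin 3))) (ω L : ℝ)
        (V : EuclideanSpace ℝ (Fin 3) → EuclideanSpace ℝ (Fin 3)) (Q : EuclideanSpace ℝ (Fin 3) → ℝ),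
        (∀ (φ : ℝ) (x : EuclideanSpace ℝ (Fin 3)),
            Rot φ x 0 = Real.cos φ * x 0 - Real.sin φ * x 1 ∧
            Rot φ x 1 = Real.sin φ * x 0 + Real.cos φ * x 1 ∧ Rot φ x 2 = x 2) →
        ContDiff ℝ (⊤ : ℕ∞) V → ContDiff ℝ (⊤ : ℕ∞) Q →
        Literature.Analysis.FluidPDE.VectorCalculus.IsDivFree V →
        (∀ y : EuclideanSpace ℝ (Fin 3),
            ω • (Literature.Analysis.FluidPDE.cross (EuclideanSpace.single (2 : Fin 3) (1 : ℝ)) (V y)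
                  - fderiv ℝ V y (Literature.Analysis.FluidPDE.cross (EuclideanSpace.single (2 : Fin 3) (1 : ℝ)) y))
              + (1 / 2 : ℝ) • V y + (1 / 2 : ℝ) • fderiv ℝ V y y
              + Literature.Analysis.FluidPDE.convect V V y + gradient Q y
              = Laplacian.laplacian V y) →
        (∀ y : EuclideanSpace ℝ (Fin 3), (1 + ‖y‖) * ‖V y‖ ≤ C) →
        (∃ y : EuclideanSpace ℝ (Fin 3), Rot (ω * L) (V (Rot (-(ω * L)) y)) ≠ V y) →
        α₁ ≤ |ω| ∧ |ω| ≤ α₂ := by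
  obtain ⟨α₁, α₂, hα₁, hα₂, H⟩ := relativeEquilibrium_eq_zero_of_extreme_rotation hC
  refine ⟨α₁, α₂, hα₁, hα₂, fun Rot ω L V Q hRot hV hQ hdiv hEq hVb hne => ?_⟩
  by_contra hω
  have hω' : |ω| < α₁ ∨ α₂ < |ω| := by
    rcases not_and_or.1 hω with h | h
    · exact Or.inl (lt_of_not_ge h)
    · exact Or.inr (lt_of_not_ge h)
  have hV0 : V = 0 := H Rot ω V Q hRot hV hQ hdiv hEq hVb hω'
  obtain ⟨y, hy⟩ := hne
  exact hy (by simp [hV0])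

/-- **A relative equilibrium tangent to the spheres about the origin vanishes** (the route's landed
`SphereTangentLiouville`, stmt-NavierStokesRegularity-1365, for the rotating wave). For the rotation
family about `e₃` pinned by coordinates, any smooth divergence-free solution `(V, Q)` of (RE_ω) in the
envelope `(1 + ‖y‖)‖V y‖ ≤ C`, `|Q y| ≤ C` with `⟪y, V y⟫ = 0` for all `y` is trivial: its rotating wave
is a Type-I rotated-DSS ancient mild solution tangent to the spheres (`⟪x, u(t,x)⟫ = ⟪R_{−ωs} x,
V(R_{−ωs} x/√(−t))⟫/√(−t) = 0`), hence zero a.e. on every past slice, hence — slices being continuous —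
`V = u(−1) = 0`. So a corkscrew relative equilibrium has a radial component somewhere. -/
theorem relativeEquilibrium_eq_zero_of_sphereTangent
    (Rot : ℝ → (EuclideanSpace ℝ (Fin 3) ≃ₗᵢ[ℝ] EuclideanSpace ℝ (Fin 3))) (ω : ℝ)
    (V : EuclideanSpace ℝ (Fin 3) → EuclideanSpace ℝ (Fin 3)) (Q : EuclideanSpace ℝ (Fin 3) → ℝ) {C : ℝ}
    (hRot : ∀ (φ : ℝ) (x : EuclideanSpace ℝ (Fin 3)),
        Rot φ x 0 = Real.cos φ * x 0 - Real.sin φ * x 1 ∧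
        Rot φ x 1 = Real.sin φ * x 0 + Real.cos φ * x 1 ∧ Rot φ x 2 = x 2)
    (hV : ContDiff ℝ (⊤ : ℕ∞) V) (hQ : ContDiff ℝ (⊤ : ℕ∞) Q)
    (hdiv : Literature.Analysis.FluidPDE.VectorCalculus.IsDivFree V)
    (hEq : ∀ y : EuclideanSpace ℝ (Fin 3),
        ω • (Literature.Analysis.FluidPDE.cross (EuclideanSpace.single (2 : Fin 3) (1 : ℝ)) (V y)
              - fderiv ℝ V y (Literature.Analysis.FluidPDE.cross (EuclideanSpace.single (2 : Fin 3) (1 : ℝ)) y))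
          + (1 / 2 : ℝ) • V y + (1 / 2 : ℝ) • fderiv ℝ V y y
          + Literature.Analysis.FluidPDE.convect V V y + gradient Q y
          = Laplacian.laplacian V y)
    (hVb : ∀ y : EuclideanSpace ℝ (Fin 3), (1 + ‖y‖) * ‖V y‖ ≤ C)
    (hQb : ∀ y : EuclideanSpace ℝ (Fin 3), |Q y| ≤ C)
    (htan : ∀ y : EuclideanSpace ℝ (Fin 3), ⟪y, V y⟫_ℝ = 0) : V = 0 := by
  obtain ⟨hcl, hrdss, hTI, -, hmild, hslice⟩ :=
    rotatingWave_data (L := 1) Rot ω V Q hRot hV hQ hdiv hEq hVb hQb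
  set u : ℝ → (EuclideanSpace ℝ (Fin 3)) → (EuclideanSpace ℝ (Fin 3)) := ofLerayOrbit fun s y => Rot (ω * s) (V (Rot (-(ω * s)) y)) with hu
  have hc1 : 1 < Real.exp (1 / 2) := Real.one_lt_exp_iff.2 (by norm_num)
  have hcont : ∀ t < 0, Continuous (u t) := fun t ht => (hcl.contDiff_velocity ht).continuous
  -- the rotating wave is tangent to the spheres
  have htan' : ∀ t < 0, ∀ x : (EuclideanSpace ℝ (Fin 3)), ⟪x, u t x⟫_ℝ = 0 := by
    intro t ht x
    have ha : 0 < Real.sqrt (-t) := Real.sqrt_pos.2 (by linarith)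
    set s : ℝ := -Real.log (-t) with hs
    set z : (EuclideanSpace ℝ (Fin 3)) := Rot (-(ω * s)) ((Real.sqrt (-t))⁻¹ • x) with hz
    have hx : Rot (-(ω * s)) x = Real.sqrt (-t) • z := by
      rw [hz, LinearIsometryEquiv.map_smul, smul_smul, mul_inv_cancel₀ ha.ne', one_smul]
    have h1 : ⟪x, Rot (ω * s) (V z)⟫_ℝ = ⟪Rot (-(ω * s)) x, V z⟫_ℝ := by
      rw [← rot_symm_apply_eq Rot hRot,
        ← LinearIsometryEquiv.inner_map_map (Rot (ω * s)) ((Rot (ω * s)).symm x) (V z),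
        LinearIsometryEquiv.apply_symm_apply]
    simp only [hu, ofLerayOrbit_apply]
    rw [real_inner_smul_right, ← hs, ← hz, h1, hx, real_inner_smul_left, htan z, mul_zero, mul_zero]
  have hST := Summit.NavierStokesRegularity.NavierStokesRegularity.Theorems.sphereTangentLiouville_proof
  unfold Summit.NavierStokesRegularity.NavierStokesRegularity.Theses.CorkscrewDynamo.SphereTangentLiouville at hST
  have hae := hST _ _ u hc1 hmild (fun t ht => (hcont t ht).aestronglyMeasurable) hrdss ⟨C, hTI⟩ htan'
    (-1) (by norm_num)
  have hzero : u (-1) = 0 := Measure.eq_of_ae_eq hae (hcont _ (by norm_num)) continuous_zero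
  funext x
  rw [← hslice x]
  show u (-1) x = 0
  rw [hzero]
  rfl

/-- A nonpositive envelope constant carries no profile at all: `(1 + ‖y‖)‖V y‖ ≤ C ≤ 0` forces
`V = 0` (so `stub_relativeEquilibrium` needs `C > 0`, where the window theorem applies). -/
theorem relativeEquilibrium_eq_zero_of_nonpos {C : ℝ} (hC : C ≤ 0) {V : (EuclideanSpace ℝ (Fin 3)) → (EuclideanSpace ℝ (Fin 3))}
    (hVb : ∀ y : (EuclideanSpace ℝ (Fin 3)), (1 + ‖y‖) * ‖V y‖ ≤ C) : V = 0 := by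
  funext y
  have h1 : (1 + ‖y‖) * ‖V y‖ ≤ 0 := (hVb y).trans hC
  have h2 : 0 < 1 + ‖y‖ := by positivity
  have h3 : ‖V y‖ ≤ 0 := by
    by_contra h
    push Not at h
    linarith [mul_pos h2 h]
  simpa using le_antisymm h3 (norm_nonneg _)

/-- **Registered stub `stub_rotationWindow` — the rotation window of a corkscrew relative
equilibrium** (= `relativeEquilibrium_rotation_window`, Pineau–Vicol 2026 Thm 1.4 transported through
the co-rotating frame): for every envelope constant `C > 0` there are `α₁, α₂ > 0` such that every
witness of the body of `stub_relativeEquilibrium` with that constant has `α₁ ≤ |ω| ≤ α₂`. -/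
theorem stub_rotationWindow :
    ∀ C : ℝ, 0 < C → ∃ α₁ α₂ : ℝ, 0 < α₁ ∧ 0 < α₂ ∧
      ∀ (Rot : ℝ → (EuclideanSpace ℝ (Fin 3) ≃ₗᵢ[ℝ] EuclideanSpace ℝ (Fin 3))) (ω L : ℝ)
        (V : EuclideanSpace ℝ (Fin 3) → EuclideanSpace ℝ (Fin 3)) (Q : EuclideanSpace ℝ (Fin 3) → ℝ),
        (∀ (φ : ℝ) (x : EuclideanSpace ℝ (Fin 3)),
            Rot φ x 0 = Real.cos φ * x 0 - Real.sin φ * x 1 ∧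
            Rot φ x 1 = Real.sin φ * x 0 + Real.cos φ * x 1 ∧ Rot φ x 2 = x 2) →
        ContDiff ℝ (⊤ : ℕ∞) V → ContDiff ℝ (⊤ : ℕ∞) Q →
        Literature.Analysis.FluidPDE.VectorCalculus.IsDivFree V →
        (∀ y : EuclideanSpace ℝ (Fin 3),
            ω • (Literature.Analysis.FluidPDE.cross (EuclideanSpace.single (2 : Fin 3) (1 : ℝ)) (V y)
                  - fderiv ℝ V y (Literature.Analysis.FluidPDE.cross (EuclideanSpace.single (2 : Fin 3) (1 : ℝ)) y))
              + (1 / 2 : ℝ) • V y + (1 / 2 : ℝ) • fderiv ℝ V y y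
              + Literature.Analysis.FluidPDE.convect V V y + gradient Q y
              = Laplacian.laplacian V y) →
        (∀ y : EuclideanSpace ℝ (Fin 3), (1 + ‖y‖) * ‖V y‖ ≤ C) →
        (∃ y : EuclideanSpace ℝ (Fin 3), Rot (ω * L) (V (Rot (-(ω * L)) y)) ≠ V y) →
        α₁ ≤ |ω| ∧ |ω| ≤ α₂ :=
  fun _ hC => relativeEquilibrium_rotation_window hC

/-- **Registered stub `stub_noSphereTangentEquilibrium` — a corkscrew relative equilibrium is nowhere
the toroidal type** (= `relativeEquilibrium_eq_zero_of_sphereTangent`, the route's landed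
`SphereTangentLiouville` for the rotating wave): a solution of (RE_ω) in the envelope which is tangent
to every sphere about the origin, `⟪y, V y⟫ = 0`, vanishes identically. -/
theorem stub_noSphereTangentEquilibrium :
    ∀ (Rot : ℝ → (EuclideanSpace ℝ (Fin 3) ≃ₗᵢ[ℝ] EuclideanSpace ℝ (Fin 3))) (ω C : ℝ)
      (V : EuclideanSpace ℝ (Fin 3) → EuclideanSpace ℝ (Fin 3)) (Q : EuclideanSpace ℝ (Fin 3) → ℝ),
        (∀ (φ : ℝ) (x : EuclideanSpace ℝ (Fin 3)),
            Rot φ x 0 = Real.cos φ * x 0 - Real.sin φ * x 1 ∧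
            Rot φ x 1 = Real.sin φ * x 0 + Real.cos φ * x 1 ∧ Rot φ x 2 = x 2) →
        ContDiff ℝ (⊤ : ℕ∞) V → ContDiff ℝ (⊤ : ℕ∞) Q →
        Literature.Analysis.FluidPDE.VectorCalculus.IsDivFree V →
        (∀ y : EuclideanSpace ℝ (Fin 3),
            ω • (Literature.Analysis.FluidPDE.cross (EuclideanSpace.single (2 : Fin 3) (1 : ℝ)) (V y)
                  - fderiv ℝ V y (Literature.Analysis.FluidPDE.cross (EuclideanSpace.single (2 : Fin 3) (1 : ℝ)) y))
              + (1 / 2 : ℝ) • V y + (1 / 2 : ℝ) • fderiv ℝ V y y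
              + Literature.Analysis.FluidPDE.convect V V y + gradient Q y
              = Laplacian.laplacian V y) →
        (∀ y : EuclideanSpace ℝ (Fin 3), (1 + ‖y‖) * ‖V y‖ ≤ C) →
        (∀ y : EuclideanSpace ℝ (Fin 3), |Q y| ≤ C) →
        (∀ y : EuclideanSpace ℝ (Fin 3), inner ℝ y (V y) = 0) → V = 0 :=
  fun Rot ω _ V Q hRot hV hQ hdiv hEq hVb hQb htan =>
    relativeEquilibrium_eq_zero_of_sphereTangent Rot ω V Q hRot hV hQ hdiv hEq hVb hQb htan

end Summit.NavierStokesRegularity.NavierStokesRegularity.Theorems.CorkscrewProfile.Birth
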